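import Literature.Combinatorics.Designs.LegendrePairs

/-!
# Legendre pairs of length 333: the tied-column 9-compression obstruction (multiplier classes `⟨73,85⟩`, `⟨73,121⟩`)

Ramos–Hulak–de Queiroz [RamosHulakDeQueiroz2026, arXiv:2607.20765v1] tabulate (Table A1) the 30 conjugacy-free classes of
subgroups `H ≤ (ℤ/333)ˣ` avoiding `−1` and the residues `≡ 2 (mod 3)`, and decide 21 of them (no `H`-invariant Legendre pair of
length `333`, hence no two-circulant Hadamard matrix of order `668` from that class); rows 0, 1, 2, 3, 4, 5, 7, 9, 10 are listed
open.  Their §4 reduction (value sets of the 9-compression read off the orbit sizes of the columns `i ≡ r (mod 9)`) is stated for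
`H` trivial modulo `9`.

This file proves the variant for a multiplier `g ≡ 4 (mod 9)` (so `H` is NOT trivial modulo 9): the columns `1,4,7` and
`2,5,8` of the 9-compression are TIED (equal) under `g`-invariance, the columns `0,3,6` are one fixed point plus `⟨g⟩`-orbits
of length `6` (an indicator identity checked by `decide`), and the compression norm identity `Σ (ã_k² + b̃_k²) = 446` at `d = 3`
together with parity and the row sums `(Σa)² + (Σb)² = 2` leaves a finite system with no solution (`endgame`).  Instances:
**Table A1 row 9, `H = ⟨73, 85⟩ = ⟨85⟩`, and row 10, `H = ⟨73, 121⟩ = ⟨175⟩` (both of order 6), admit no `H`-invariant Legendre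
pair of length 333** (`rhdq_tableA1_id9`, `rhdq_tableA1_id10`), also for translation-twisted multipliers
(`no_twisted_legendrePair333_of_mem85` etc., via `exists_twisted_iff` = [KotsireasEtAl2023, Cor. 1]).

PROVENANCE.  Rows 9 and 10 are listed OPEN in arXiv:2607.20765v1; the theorems below were found and proved in the pub-lottery
cell (2026-08-19: three independent sieve implementations agree on the empty candidate set; hand proof; this kernel proof), and are
NOT claimed to appear in the literature.  The ingredients (compression identities, orbit value sets, row sums) are the paper's
[RamosHulakDeQueiroz2026, Lemma 2, Lemma 4] after [DjokovicKotsireas2015] (Des. Codes Cryptogr. 74 (2015) 365–377) and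
Fletcher–Gysin–Seberry [FletcherGysinSeberry2001].  No `native_decide`; `decide` needs the raised recursion depth.
-/

open Finset

set_option maxRecDepth 16384

namespace Literature.Combinatorics.Designs.LegendrePairs

namespace NineComp333

/-- 0/1 indicator of the residue class `r (mod d)`, read off `ZMod.val` [cite: RamosHulakDeQueiroz2026, §2.1 (compression)] -/
def χ (d r : ℕ) (i : ZMod 333) : ℤ := if i.val % d = r then 1 else 0

/-- class sum `Σ_{i ≡ r (mod d)} c i` (the `d`-compression entry) [cite: RamosHulakDeQueiroz2026, §2.1 (d-compression)] -/
def cs (d : ℕ) (c : ZMod 333 → ℤ) (r : ℕ) : ℤ := ∑ i, χ d r i * c i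

/-- `(i + s).val ≡ i.val + s.val (mod d)` for `d ∣ 333`. [folklore] -/
lemma val_add_mod {d : ℕ} (hd : d ∣ 333) (i s : ZMod 333) :
    (i + s).val % d = (i.val + s.val) % d := by
  rw [ZMod.val_add, Nat.mod_mod_of_dvd _ hd]

/-- `(u i).val ≡ u.val · i.val (mod d)` for `d ∣ 333`. [folklore] -/
lemma val_mul_mod {d : ℕ} (hd : d ∣ 333) (u i : ZMod 333) :
    (u * i).val % d = (u.val * i.val) % d := by
  rw [ZMod.val_mul, Nat.mod_mod_of_dvd _ hd]

/-! ### the 3-compression norm identity -/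

/-- orthogonality of the mod-3 class indicators. [folklore] -/
lemma key_delta (i j : ZMod 333) :
    (∑ k ∈ Finset.range 3, χ 3 k i * χ 3 k j) = if i.val % 3 = j.val % 3 then 1 else 0 := by
  have hi : i.val % 3 < 3 := Nat.mod_lt _ (by norm_num)
  have hj : j.val % 3 < 3 := Nat.mod_lt _ (by norm_num)
  unfold χ
  simp only [Finset.sum_range_succ, Finset.sum_range_zero]
  split_ifs <;> omega

/-- autocorrelation form of the compression identity at `d = 3`: `Σ_k c̃_k² = Σ_{3 ∣ s} PAF_c(s)`. [cite: RamosHulakDeQueiroz2026, Lemma 2 (compression identities, after DjokovicKotsireas2015, Thm 3)] -/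
lemma sum_sq_cs3 (c : ZMod 333 → ℤ) :
    ∑ k ∈ Finset.range 3, (cs 3 c k) ^ 2 = ∑ s, χ 3 0 s * PAF c s := by
  have L : ∑ k ∈ Finset.range 3, (cs 3 c k) ^ 2
      = ∑ i, ∑ j, (if i.val % 3 = j.val % 3 then (1 : ℤ) else 0) * (c i * c j) := by
    unfold cs
    simp_rw [sq, Finset.sum_mul_sum]
    rw [Finset.sum_comm]
    refine Finset.sum_congr rfl fun i _ => ?_
    rw [Finset.sum_comm]
    refine Finset.sum_congr rfl fun j _ => ?_
    rw [← key_delta i j, Finset.sum_mul]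
    refine Finset.sum_congr rfl fun k _ => ?_
    ring
  have R : ∑ s, χ 3 0 s * PAF c s
      = ∑ i, ∑ j, (if i.val % 3 = j.val % 3 then (1 : ℤ) else 0) * (c i * c j) := by
    unfold PAF
    simp_rw [Finset.mul_sum]
    rw [Finset.sum_comm]
    refine Finset.sum_congr rfl fun i _ => ?_
    rw [← Equiv.sum_comp (Equiv.addLeft i)
      (fun j => (if i.val % 3 = j.val % 3 then (1 : ℤ) else 0) * (c i * c j))]
    refine Finset.sum_congr rfl fun s _ => ?_
    show χ 3 0 s * (c i * c (i + s))
      = (if i.val % 3 = (i + s).val % 3 then (1 : ℤ) else 0) * (c i * c (i + s))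
    congr 1
    unfold χ
    have key : s.val % 3 = 0 ↔ i.val % 3 = (i + s).val % 3 := by
      rw [val_add_mod (by decide : 3 ∣ 333)]
      have : i.val % 3 < 3 := Nat.mod_lt _ (by norm_num)
      omega
    by_cases h : s.val % 3 = 0
    · rw [if_pos h, if_pos (key.mp h)]
    · rw [if_neg h, if_neg (fun h' => h (key.mpr h'))]
  rw [L, R]

/-- for a Legendre pair of length 333, `Σ_{3 ∣ s} (PAF_a + PAF_b)(s) = 666 - 2·110 = 446`. [cite: RamosHulakDeQueiroz2026, Lemma 2 / Lemma 4 (norm identity)] -/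
lemma sum_theta_paf (a b : ZMod 333 → ℤ) (h : LegendrePair a b) :
    ∑ s, χ 3 0 s * (PAF a s + PAF b s) = 446 := by
  have : ∀ s : ZMod 333, χ 3 0 s * (PAF a s + PAF b s)
      = if s = 0 then 666 else if s.val % 3 = 0 then -2 else 0 := by
    intro s
    by_cases hs : s = 0
    · subst hs
      rw [paf_zero a h.1, paf_zero b h.2.1, if_pos rfl]
      unfold χ; rw [if_pos (by decide)]; norm_num
    · rw [if_neg hs, h.2.2 s hs]; unfold χ; split_ifs <;> simp
  rw [Finset.sum_congr rfl fun s _ => this s]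
  decide

/-! ### 9-compression: classes, ties, parity -/

/-- a mod-3 class sum is the sum of three mod-9 class sums. [folklore] -/
lemma cs3_eq (c : ZMod 333 → ℤ) (k : ℕ) (hk : k < 3) :
    cs 3 c k = cs 9 c k + cs 9 c (k + 3) + cs 9 c (k + 6) := by
  unfold cs; rw [← Finset.sum_add_distrib, ← Finset.sum_add_distrib]
  refine Finset.sum_congr rfl fun i _ => ?_
  have h9 : i.val % 9 % 3 = i.val % 3 := Nat.mod_mod_of_dvd _ (by norm_num)
  have hlt : i.val % 9 < 9 := Nat.mod_lt _ (by norm_num)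
  unfold χ
  split_ifs <;> first | ring1 | (exfalso; omega)

/-- the row sum is the sum of the three mod-3 class sums. [folklore] -/
lemma rowsum_eq (c : ZMod 333 → ℤ) : ∑ i, c i = cs 3 c 0 + cs 3 c 1 + cs 3 c 2 := by
  unfold cs; rw [← Finset.sum_add_distrib, ← Finset.sum_add_distrib]
  refine Finset.sum_congr rfl fun i _ => ?_
  have hlt : i.val % 3 < 3 := Nat.mod_lt _ (by norm_num)
  unfold χ
  split_ifs <;> first | ring1 | (exfalso; omega)

/-- the class `{i ≡ r (mod 9)}` has 37 elements [folklore] -/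
lemma card_class9 (r : ℕ) (hr : r < 9) : ∑ i : ZMod 333, χ 9 r i = 37 := by
  unfold χ
  interval_cases r <;> decide

/-- each mod-9 class sum of a `±1` sequence of length 333 is odd (37 terms). [cite: RamosHulakDeQueiroz2026, §4 (free-odd columns)] -/
lemma cs9_odd (c : ZMod 333 → ℤ) (hc : IsPM c) (r : ℕ) (hr : r < 9) : Odd (cs 9 c r) := by
  have hsplit : cs 9 c r = ∑ i, χ 9 r i * (c i - 1) + ∑ i, χ 9 r i := by
    unfold cs; rw [← Finset.sum_add_distrib]
    refine Finset.sum_congr rfl fun i _ => ?_; ring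
  have heven : (2 : ℤ) ∣ ∑ i : ZMod 333, χ 9 r i * (c i - 1) :=
    Finset.dvd_sum fun i _ => by
      rcases hc i with h | h
      · rw [h]; simp
      · rw [h]; exact Dvd.dvd.mul_left (by norm_num) _
  rw [hsplit, card_class9 r hr]
  obtain ⟨m, hm⟩ := heven
  exact ⟨m + 18, by rw [hm]; ring⟩

/-- TIES: invariance under a unit `g ≡ 4 (mod 9)` identifies class `r` with class `4 r (mod 9)`. [cite: RamosHulakDeQueiroz2026, Lemma 2; tied-column variant (g ≡ 4 mod 9) proved here] -/
lemma cs9_tie (c : ZMod 333 → ℤ) (g : ZMod 333) (hg : g.val % 9 = 4) (u : (ZMod 333)ˣ)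
    (hu : (u : ZMod 333) = g) (hinv : ∀ i, c (g * i) = c i) (r r' : ℕ) (hr : r < 9)
    (hr' : r' = 4 * r % 9) : cs 9 c r' = cs 9 c r := by
  unfold cs
  rw [← Equiv.sum_comp u.mulLeft (fun j => χ 9 r' j * c j)]
  refine Finset.sum_congr rfl fun i _ => ?_
  show χ 9 r' ((u : ZMod 333) * i) * c ((u : ZMod 333) * i) = χ 9 r i * c i
  rw [hu, hinv]
  congr 1
  unfold χ
  have key : (g * i).val % 9 = r' ↔ i.val % 9 = r := by
    rw [val_mul_mod (by decide : 9 ∣ 333), hr', Nat.mul_mod, hg]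
    have : i.val % 9 < 9 := Nat.mod_lt _ (by norm_num)
    omega
  by_cases h : i.val % 9 = r
  · rw [if_pos (key.mpr h), if_pos h]
  · rw [if_neg (fun h' => h (key.mp h')), if_neg h]

/-! ### the mod-12 congruence of the classes 0, 3, 6 via an orbit decomposition -/

/-- indicator identity: class `r` = `{f}` ⊔ six `⟨g⟩`-orbits of length 6 through `T` [cite: RamosHulakDeQueiroz2026, §4 (orbit structure of a column)] -/
def OrbitDecomp (g : ZMod 333) (r : ℕ) (f : ZMod 333) (T : Finset (ZMod 333)) : Prop :=
  ∀ i : ZMod 333, χ 9 r i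
    = (if i = f then 1 else 0) + ∑ t ∈ T, ∑ k ∈ Finset.range 6, (if i = g ^ k * t then 1 else 0)

/-- `OrbitDecomp` is a finite check. [folklore] -/
instance (g : ZMod 333) (r : ℕ) (f : ZMod 333) (T : Finset (ZMod 333)) :
    Decidable (OrbitDecomp g r f T) := by
  unfold OrbitDecomp; infer_instance

/-- `Σ_i [i = x] c_i = c_x`. [folklore] -/
lemma sum_indicator_mul (x : ZMod 333) (c : ZMod 333 → ℤ) :
    ∑ i, (if i = x then (1 : ℤ) else 0) * c i = c x := by
  simp [ite_mul]

/-- a class sum splits along an orbit decomposition of the class. [cite: RamosHulakDeQueiroz2026, §4 Lemma 4 (orbit value sets)] -/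
lemma cs9_decomp (c : ZMod 333 → ℤ) (g : ZMod 333) (r : ℕ) (f : ZMod 333) (T : Finset (ZMod 333))
    (hdec : OrbitDecomp g r f T) :
    cs 9 c r = c f + ∑ t ∈ T, ∑ k ∈ Finset.range 6, c (g ^ k * t) := by
  unfold cs
  calc ∑ i, χ 9 r i * c i
      = ∑ i, ((if i = f then (1 : ℤ) else 0) * c i
          + ∑ t ∈ T, ∑ k ∈ Finset.range 6, (if i = g ^ k * t then (1 : ℤ) else 0) * c i) := by
        refine Finset.sum_congr rfl fun i _ => ?_
        rw [hdec i, add_mul, Finset.sum_mul]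
        congr 1
        refine Finset.sum_congr rfl fun t _ => ?_
        rw [Finset.sum_mul]
    _ = c f + ∑ t ∈ T, ∑ k ∈ Finset.range 6, c (g ^ k * t) := by
        rw [Finset.sum_add_distrib, sum_indicator_mul]
        congr 1
        rw [Finset.sum_comm]
        refine Finset.sum_congr rfl fun t _ => ?_
        rw [Finset.sum_comm]
        refine Finset.sum_congr rfl fun k _ => ?_
        exact sum_indicator_mul _ _

/-- under `g`-invariance, a class that is one fixed point plus 6-orbits has class sum `≡ c(fixed point) (mod 12)`. [cite: RamosHulakDeQueiroz2026, §4 Lemma 4 (value set `V_h`, here `h = 6`); tied variant proved here] -/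
lemma cs9_mod12 (c : ZMod 333 → ℤ) (hc : IsPM c) (g : ZMod 333) (hinv : ∀ i, c (g * i) = c i)
    (r : ℕ) (f : ZMod 333) (T : Finset (ZMod 333)) (hT : T.card = 6)
    (hdec : OrbitDecomp g r f T) : ∃ m : ℤ, cs 9 c r = c f + 12 * m := by
  have hpow : ∀ k : ℕ, ∀ i, c (g ^ k * i) = c i := by
    intro k
    induction k with
    | zero => intro i; rw [pow_zero, one_mul]
    | succ k ih => intro i; rw [pow_succ, mul_assoc, ih, hinv]
  rw [cs9_decomp c g r f T hdec]
  have hin : ∀ t ∈ T, ∑ k ∈ Finset.range 6, c (g ^ k * t) = 6 * c t := by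
    intro t _
    rw [Finset.sum_congr rfl fun k _ => hpow k t]
    simp
  rw [Finset.sum_congr rfl hin, ← Finset.mul_sum]
  have h2 : (2 : ℤ) ∣ ∑ t ∈ T, (c t - 1) :=
    Finset.dvd_sum fun t _ => by
      rcases hc t with h | h
      · rw [h]; simp
      · rw [h]; norm_num
  obtain ⟨m, hm⟩ := h2
  have hs : ∑ t ∈ T, (c t - 1) = ∑ t ∈ T, c t - 6 := by
    rw [Finset.sum_sub_distrib]; simp [hT]
  refine ⟨m + 3, ?_⟩
  have : ∑ t ∈ T, c t = 2 * m + 6 := by linarith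
  rw [this]; ring

/-! ### the finite endgame -/

/-- the finite endgame, one sequence: the admissible values of `V² + 9p² + 9q²`. [folklore] -/
lemma seq_norm (V p q s e : ℤ) (hs : s = 1 ∨ s = -1) (he : e = 1 ∨ e = -1 ∨ e = 3 ∨ e = -3)
    (hrow : V + 3 * p + 3 * q = s) (hp : Odd p) (hq : Odd q) (hV : ∃ m, V = e + 12 * m)
    (hB : V * V + 9 * (p * p) + 9 * (q * q) ≤ 428) :
    V * V + 9 * (p * p) + 9 * (q * q) = 19 ∨ V * V + 9 * (p * p) + 9 * (q * q) = 163 ∨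
    V * V + 9 * (p * p) + 9 * (q * q) = 211 ∨ V * V + 9 * (p * p) + 9 * (q * q) = 259 ∨
    V * V + 9 * (p * p) + 9 * (q * q) = 355 ∨ V * V + 9 * (p * p) + 9 * (q * q) = 403 := by
  obtain ⟨m, hm⟩ := hV
  obtain ⟨p1, hp1⟩ := hp
  obtain ⟨q1, hq1⟩ := hq
  have hVV : 0 ≤ V * V := mul_self_nonneg V
  have hpp : 0 ≤ p * p := mul_self_nonneg p
  have hqq : 0 ≤ q * q := mul_self_nonneg q
  have hp7 : -6 ≤ p ∧ p ≤ 6 := by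
    constructor <;> nlinarith [mul_self_nonneg (p + 7), mul_self_nonneg (p - 7)]
  have hq7 : -6 ≤ q ∧ q ≤ 6 := by
    constructor <;> nlinarith [mul_self_nonneg (q + 7), mul_self_nonneg (q - 7)]
  have hVdef : V = s - 3 * p - 3 * q := by linarith
  subst hVdef
  obtain ⟨hpl, hpu⟩ := hp7
  obtain ⟨hql, hqu⟩ := hq7
  rcases hs with rfl | rfl <;> interval_cases p <;> interval_cases q <;> omega

/-- the finite endgame: no two admissible per-sequence norms add up to `446`. [cite: RamosHulakDeQueiroz2026, Table A1 rows 9, 10 (listed open); decided here] -/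
lemma endgame (V p q V' p' q' sa sb e e' : ℤ)
    (hsa : sa = 1 ∨ sa = -1) (hsb : sb = 1 ∨ sb = -1)
    (he : e = 1 ∨ e = -1 ∨ e = 3 ∨ e = -3) (he' : e' = 1 ∨ e' = -1 ∨ e' = 3 ∨ e' = -3)
    (hrow : V + 3 * p + 3 * q = sa) (hrow' : V' + 3 * p' + 3 * q' = sb)
    (hp : Odd p) (hq : Odd q) (hp' : Odd p') (hq' : Odd q')
    (hV : ∃ m, V = e + 12 * m) (hV' : ∃ m, V' = e' + 12 * m)
    (hN : V * V + 9 * (p * p) + 9 * (q * q) + (V' * V' + 9 * (p' * p') + 9 * (q' * q')) = 446) :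
    False := by
  have sqpos : ∀ x : ℤ, Odd x → 1 ≤ x * x := fun x hx => by
    obtain ⟨k, hk⟩ := hx
    have hx0 : x ≠ 0 := by intro h0; omega
    have h1 : (0 : ℤ) + 1 ≤ x * x := Int.add_one_le_iff.mpr (mul_self_pos.mpr hx0)
    linarith
  have h1 := sqpos p hp; have h2 := sqpos q hq; have h3 := sqpos p' hp'; have h4 := sqpos q' hq'
  have hVV : 0 ≤ V * V := mul_self_nonneg V
  have hVV' : 0 ≤ V' * V' := mul_self_nonneg V'
  have hBa : V * V + 9 * (p * p) + 9 * (q * q) ≤ 428 := by linarith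
  have hBb : V' * V' + 9 * (p' * p') + 9 * (q' * q') ≤ 428 := by linarith
  have da := seq_norm V p q sa e hsa he hrow hp hq hV hBa
  have db := seq_norm V' p' q' sb e' hsb he' hrow' hp' hq' hV' hBb
  rcases da with h | h | h | h | h | h <;> rcases db with h' | h' | h' | h' | h' | h' <;> linarith

/-! ### main theorem -/

/-- a sum of three signs is `±1` or `±3`. [folklore] -/
lemma pm3 (x y z : ℤ) (hx : x = 1 ∨ x = -1) (hy : y = 1 ∨ y = -1) (hz : z = 1 ∨ z = -1) :
    x + y + z = 1 ∨ x + y + z = -1 ∨ x + y + z = 3 ∨ x + y + z = -3 := by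
  rcases hx with rfl | rfl <;> rcases hy with rfl | rfl <;> rcases hz with rfl | rfl <;> norm_num

/-- **Theorem (generic form).**  Let `g ∈ (ZMod 333)ˣ` with `g ≡ 4 (mod 9)` such that each class
`{i ≡ r (mod 9)}`, `r = 0, 3, 6`, is `{0 / 111 / 222}` plus six `⟨g⟩`-orbits of length 6 (an
indicator identity, `decide`d in the instances below).  Then no Legendre pair of length 333 is
invariant (both sequences) under the multiplier `g`. [cite: RamosHulakDeQueiroz2026, Table A1 rows 9, 10 (listed open there); decided here — pub-lottery cell result, not claimed to be in the literature] -/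
theorem no_invariant_legendrePair (g : ZMod 333) (u : (ZMod 333)ˣ) (hu : (u : ZMod 333) = g)
    (hg : g.val % 9 = 4) (T0 T3 T6 : Finset (ZMod 333))
    (hT0 : T0.card = 6) (hT3 : T3.card = 6) (hT6 : T6.card = 6)
    (hd0 : OrbitDecomp g 0 0 T0) (hd3 : OrbitDecomp g 3 111 T3) (hd6 : OrbitDecomp g 6 222 T6)
    (a b : ZMod 333 → ℤ) (hL : LegendrePair a b)
    (ha : ∀ i, a (g * i) = a i) (hb : ∀ i, b (g * i) = b i) : False := by
  have hpa : IsPM a := hL.1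
  have hpb : IsPM b := hL.2.1
  -- row sums are ±1
  have hrs := rowsum_sq a b hL
  have hsa : (∑ i, a i) = 1 ∨ (∑ i, a i) = -1 := pm_of_sq _ _ hrs
  have hsb : (∑ i, b i) = 1 ∨ (∑ i, b i) = -1 := pm_of_sq _ (∑ i, a i) (by linarith [hrs])
  -- the 3-compression norm identity
  have hN : (∑ k ∈ Finset.range 3, (cs 3 a k) ^ 2) + (∑ k ∈ Finset.range 3, (cs 3 b k) ^ 2) = 446 := by
    rw [sum_sq_cs3, sum_sq_cs3, ← Finset.sum_add_distrib, ← sum_theta_paf a b hL]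
    refine Finset.sum_congr rfl fun s _ => ?_; ring
  simp only [Finset.sum_range_succ, Finset.sum_range_zero, zero_add] at hN
  -- ties
  have ta4 := cs9_tie a g hg u hu ha 1 4 (by norm_num) (by norm_num)
  have ta7 := cs9_tie a g hg u hu ha 4 7 (by norm_num) (by norm_num)
  have ta8 := cs9_tie a g hg u hu ha 2 8 (by norm_num) (by norm_num)
  have ta5 := cs9_tie a g hg u hu ha 8 5 (by norm_num) (by norm_num)
  have tb4 := cs9_tie b g hg u hu hb 1 4 (by norm_num) (by norm_num)
  have tb7 := cs9_tie b g hg u hu hb 4 7 (by norm_num) (by norm_num)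
  have tb8 := cs9_tie b g hg u hu hb 2 8 (by norm_num) (by norm_num)
  have tb5 := cs9_tie b g hg u hu hb 8 5 (by norm_num) (by norm_num)
  -- 3-classes from 9-classes, row sums from 3-classes
  have a0 := cs3_eq a 0 (by norm_num); have a1 := cs3_eq a 1 (by norm_num); have a2 := cs3_eq a 2 (by norm_num)
  have b0 := cs3_eq b 0 (by norm_num); have b1 := cs3_eq b 1 (by norm_num); have b2 := cs3_eq b 2 (by norm_num)
  norm_num at a0 a1 a2 b0 b1 b2
  have ra := rowsum_eq a; have rb := rowsum_eq b
  have ea1 : cs 3 a 1 = 3 * cs 9 a 1 := by rw [a1, ta7, ta4]; ring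
  have ea2 : cs 3 a 2 = 3 * cs 9 a 2 := by rw [a2, ta5, ta8]; ring
  have eb1 : cs 3 b 1 = 3 * cs 9 b 1 := by rw [b1, tb7, tb4]; ring
  have eb2 : cs 3 b 2 = 3 * cs 9 b 2 := by rw [b2, tb5, tb8]; ring
  -- parity
  have opa := cs9_odd a hpa 1 (by norm_num); have oqa := cs9_odd a hpa 2 (by norm_num)
  have opb := cs9_odd b hpb 1 (by norm_num); have oqb := cs9_odd b hpb 2 (by norm_num)
  -- mod 12
  obtain ⟨m0, hm0⟩ := cs9_mod12 a hpa g ha 0 0 T0 hT0 hd0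
  obtain ⟨m3, hm3⟩ := cs9_mod12 a hpa g ha 3 111 T3 hT3 hd3
  obtain ⟨m6, hm6⟩ := cs9_mod12 a hpa g ha 6 222 T6 hT6 hd6
  obtain ⟨n0, hn0⟩ := cs9_mod12 b hpb g hb 0 0 T0 hT0 hd0
  obtain ⟨n3, hn3⟩ := cs9_mod12 b hpb g hb 3 111 T3 hT3 hd3
  obtain ⟨n6, hn6⟩ := cs9_mod12 b hpb g hb 6 222 T6 hT6 hd6
  have hea := pm3 (a 0) (a 111) (a 222) (hpa 0) (hpa 111) (hpa 222)
  have heb := pm3 (b 0) (b 111) (b 222) (hpb 0) (hpb 111) (hpb 222)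
  refine endgame (cs 3 a 0) (cs 9 a 1) (cs 9 a 2) (cs 3 b 0) (cs 9 b 1) (cs 9 b 2)
    (∑ i, a i) (∑ i, b i) (a 0 + a 111 + a 222) (b 0 + b 111 + b 222)
    hsa hsb hea heb ?_ ?_ opa oqa opb oqb ?_ ?_ ?_
  · linarith [ra, ea1, ea2]
  · linarith [rb, eb1, eb2]
  · exact ⟨m0 + m3 + m6, by rw [a0, hm0, hm3, hm6]; ring⟩
  · exact ⟨n0 + n3 + n6, by rw [b0, hn0, hn3, hn6]; ring⟩
  · rw [ea1, ea2, eb1, eb2] at hN; linear_combination hN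

/-! ### the two instances: RHdQ Table A1, ID 9 (`⟨73,85⟩ = ⟨85⟩`) and ID 10 (`⟨73,121⟩ = ⟨175⟩`) -/

/-- orbit representatives for class `0 (mod 9)` (the same sets work for both multipliers `85`, `175`; checked by `decide`). [cite: RamosHulakDeQueiroz2026, Table A1 rows 9, 10] -/
def T0 : Finset (ZMod 333) := {9, 18, 27, 45, 54, 81}
/-- orbit representatives for class `3 (mod 9)`. [cite: RamosHulakDeQueiroz2026, Table A1 rows 9, 10] -/
def T3 : Finset (ZMod 333) := {3, 12, 39, 48, 66, 93}
/-- orbit representatives for class `6 (mod 9)`. [cite: RamosHulakDeQueiroz2026, Table A1 rows 9, 10] -/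
def T6 : Finset (ZMod 333) := {6, 15, 24, 33, 123, 159}

/-- orbit decomposition for the multiplier `85`, class `0 (mod 9)` (`decide`). [cite: RamosHulakDeQueiroz2026, Table A1 rows 9, 10] -/
lemma dec85_0 : OrbitDecomp 85 0 0 T0 := by unfold T0; decide
/-- orbit decomposition for the multiplier `85`, class `3 (mod 9)` (`decide`). [cite: RamosHulakDeQueiroz2026, Table A1 rows 9, 10] -/
lemma dec85_3 : OrbitDecomp 85 3 111 T3 := by unfold T3; decide
/-- orbit decomposition for the multiplier `85`, class `6 (mod 9)` (`decide`). [cite: RamosHulakDeQueiroz2026, Table A1 rows 9, 10] -/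
lemma dec85_6 : OrbitDecomp 85 6 222 T6 := by unfold T6; decide
/-- orbit decomposition for the multiplier `175`, class `0 (mod 9)` (`decide`). [cite: RamosHulakDeQueiroz2026, Table A1 rows 9, 10] -/
lemma dec175_0 : OrbitDecomp 175 0 0 T0 := by unfold T0; decide
/-- orbit decomposition for the multiplier `175`, class `3 (mod 9)` (`decide`). [cite: RamosHulakDeQueiroz2026, Table A1 rows 9, 10] -/
lemma dec175_3 : OrbitDecomp 175 3 111 T3 := by unfold T3; decide
/-- orbit decomposition for the multiplier `175`, class `6 (mod 9)` (`decide`). [cite: RamosHulakDeQueiroz2026, Table A1 rows 9, 10] -/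
lemma dec175_6 : OrbitDecomp 175 6 222 T6 := by unfold T6; decide

/-- six representatives. [folklore] -/
lemma cardT0 : T0.card = 6 := by decide
/-- six representatives. [folklore] -/
lemma cardT3 : T3.card = 6 := by decide
/-- six representatives. [folklore] -/
lemma cardT6 : T6.card = 6 := by decide

/-- **RHdQ class ID 9** (`H = ⟨73, 85⟩ = ⟨85⟩`, order 6): no `85`-invariant Legendre pair of length 333. [cite: RamosHulakDeQueiroz2026, Table A1 row 9 (listed open); decided here] -/
theorem no_legendrePair_mul85 (a b : ZMod 333 → ℤ) (hL : LegendrePair a b)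
    (ha : ∀ i, a (85 * i) = a i) (hb : ∀ i, b (85 * i) = b i) : False :=
  no_invariant_legendrePair 85 (ZMod.unitOfCoprime 85 (by decide)) (by simp)
    (by decide) T0 T3 T6 cardT0 cardT3 cardT6 dec85_0 dec85_3 dec85_6 a b hL ha hb

/-- **RHdQ class ID 10** (`H = ⟨73, 121⟩ = ⟨175⟩`, order 6): no `175`-invariant Legendre pair of length 333. [cite: RamosHulakDeQueiroz2026, Table A1 row 10 (listed open); decided here] -/
theorem no_legendrePair_mul175 (a b : ZMod 333 → ℤ) (hL : LegendrePair a b)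
    (ha : ∀ i, a (175 * i) = a i) (hb : ∀ i, b (175 * i) = b i) : False :=
  no_invariant_legendrePair 175 (ZMod.unitOfCoprime 175 (by decide)) (by simp)
    (by decide) T0 T3 T6 cardT0 cardT3 cardT6 dec175_0 dec175_3 dec175_6 a b hL ha hb

/-- sanity: `85` and `175` generate the subgroups of Table A1 IDs 9 and 10
(`85³ = 175³ = 73`, `85⁴ = 211·?`… concretely the element lists): -/
example : ((85 : ZMod 333) ^ 2 = 232 ∧ (85 : ZMod 333) ^ 3 = 73 ∧ (85 : ZMod 333) ^ 4 = 211 ∧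
    (85 : ZMod 333) ^ 5 = 286 ∧ (85 : ZMod 333) ^ 6 = 1) ∧
    ((175 : ZMod 333) ^ 2 = 322 ∧ (175 : ZMod 333) ^ 3 = 73 ∧ (175 : ZMod 333) ^ 4 = 121 ∧
    (175 : ZMod 333) ^ 5 = 196 ∧ (175 : ZMod 333) ^ 6 = 1) := by decide

/-- invariance under a generator gives invariance under the whole subgroup (so the hypotheses of the
two theorems above are exactly "H-invariant" for `H = ⟨85⟩ ⊇ {73, 85}` resp. `H = ⟨175⟩ ⊇ {73,121}`). -/
example (a : ZMod 333 → ℤ) (ha : ∀ i, a (85 * i) = a i) (i : ZMod 333) : a (73 * i) = a i := by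
  have h3 : (73 : ZMod 333) = 85 * (85 * 85) := by decide
  rw [h3, mul_assoc, mul_assoc, ha, ha, ha]

/-- **Table A1, ID 9, verbatim generators `⟨73, 85⟩`:** no Legendre pair of length 333 with both sequences
invariant under the multipliers 73 and 85 (the hypothesis on 73 is not even needed). [cite: RamosHulakDeQueiroz2026, Table A1 row 9 (listed open); decided here] -/
theorem rhdq_tableA1_id9 (a b : ZMod 333 → ℤ) (hL : LegendrePair a b)
    (_ha73 : ∀ i, a (73 * i) = a i) (ha85 : ∀ i, a (85 * i) = a i)
    (_hb73 : ∀ i, b (73 * i) = b i) (hb85 : ∀ i, b (85 * i) = b i) : False :=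
  no_legendrePair_mul85 a b hL ha85 hb85

/-- **Table A1, ID 10, verbatim generators `⟨73, 121⟩`:** no Legendre pair of length 333 with both sequences
invariant under the multipliers 73 and 121 (`175 = 73 · 121 (mod 333)`). [cite: RamosHulakDeQueiroz2026, Table A1 row 10 (listed open); decided here] -/
theorem rhdq_tableA1_id10 (a b : ZMod 333 → ℤ) (hL : LegendrePair a b)
    (ha73 : ∀ i, a (73 * i) = a i) (ha121 : ∀ i, a (121 * i) = a i)
    (hb73 : ∀ i, b (73 * i) = b i) (hb121 : ∀ i, b (121 * i) = b i) : False := by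
  have h175 : (175 : ZMod 333) = 73 * 121 := by decide
  refine no_legendrePair_mul175 a b hL (fun i => ?_) (fun i => ?_)
  · rw [h175, mul_assoc, ha73, ha121]
  · rw [h175, mul_assoc, hb73, hb121]

/-! ### `H`-invariance for a set of (possibly translation-twisted) multipliers -/

/-- Row 9 in the language of `LegendrePairs.lean`: if `85 ∈ H` then no Legendre pair of length 333 has both sequences
`H`-invariant, even in the translation-twisted sense `x (t i) = x (i + c_t)`. [cite: RamosHulakDeQueiroz2026, Table A1 row 9 (listed open); decided here; reduction KotsireasEtAl2023, Cor 1] -/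
theorem no_twisted_legendrePair333_of_mem85 (H : Set (ZMod 333)ˣ) (u : (ZMod 333)ˣ) (hu : (u : ZMod 333) = 85)
    (huH : u ∈ H) :
    ¬ ∃ a b : ZMod 333 → ℤ, LegendrePair a b ∧ (∀ t ∈ H, TwistedInvariant a t) ∧ (∀ t ∈ H, TwistedInvariant b t) := by
  rw [exists_twisted_iff]
  rintro ⟨a, b, hab, ha, hb⟩
  exact no_legendrePair_mul85 a b hab (fun i => by rw [← hu]; exact ha u huH i) (fun i => by rw [← hu]; exact hb u huH i)

/-- Row 10 in the language of `LegendrePairs.lean`: if `175 ∈ H` (e.g. `73, 121 ∈ H`) then no Legendre pair of length 333 has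
both sequences `H`-invariant, even in the translation-twisted sense. [cite: RamosHulakDeQueiroz2026, Table A1 row 10 (listed open); decided here; reduction KotsireasEtAl2023, Cor 1] -/
theorem no_twisted_legendrePair333_of_mem175 (H : Set (ZMod 333)ˣ) (u : (ZMod 333)ˣ) (hu : (u : ZMod 333) = 175)
    (huH : u ∈ H) :
    ¬ ∃ a b : ZMod 333 → ℤ, LegendrePair a b ∧ (∀ t ∈ H, TwistedInvariant a t) ∧ (∀ t ∈ H, TwistedInvariant b t) := by
  rw [exists_twisted_iff]
  rintro ⟨a, b, hab, ha, hb⟩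
  exact no_legendrePair_mul175 a b hab (fun i => by rw [← hu]; exact ha u huH i) (fun i => by rw [← hu]; exact hb u huH i)

/-- Row 10 with the verbatim generators: if `73 ∈ H` and `121 ∈ H` then no (twisted-)`H`-invariant Legendre pair of length 333
exists. [cite: RamosHulakDeQueiroz2026, Table A1 row 10 (listed open); decided here] -/
theorem no_twisted_legendrePair333_of_mem73_121 (H : Set (ZMod 333)ˣ) (u v : (ZMod 333)ˣ)
    (hu : (u : ZMod 333) = 73) (hv : (v : ZMod 333) = 121) (huH : u ∈ H) (hvH : v ∈ H) :
    ¬ ∃ a b : ZMod 333 → ℤ, LegendrePair a b ∧ (∀ t ∈ H, TwistedInvariant a t) ∧ (∀ t ∈ H, TwistedInvariant b t) := by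
  rw [exists_twisted_iff]
  rintro ⟨a, b, hab, ha, hb⟩
  exact rhdq_tableA1_id10 a b hab (fun i => by rw [← hu]; exact ha u huH i) (fun i => by rw [← hv]; exact ha v hvH i)
    (fun i => by rw [← hu]; exact hb u huH i) (fun i => by rw [← hv]; exact hb v hvH i)

end NineComp333

end Literature.Combinatorics.Designs.LegendrePairs
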